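import Literature.NumberTheory.LFunctions.LevinFainleibDirichlet
import Literature.NumberTheory.LFunctions.TauberianTheoremsProofs
import HarnessLib

/-!
# The Levin–Faĭnleĭb / Halberstam–Richert logarithmic mean-value theorem (asymptotic form)

Topic `Literature/NumberTheory/LFunctions` (mean values of non-negative multiplicative functions).
Final file of the series `LevinFainleibPrimeSums` (I), `LevinFainleibLocalFactors` (II),
`LevinFainleibProduct` (III), `LevinFainleibDirichlet` (IV).  Everything here is PROVED.

**Theorem** (`levinFainleib_asymp`; Levin–Faĭnleĭb 1967, Halberstam–Richert, *Sieve Methods* (1974)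
Lemma 5.4, Wirsing; asymptotic form with the constant identified).  Let `g ≥ 0` be multiplicative
(`g 1 = 1`, `g(mn) = g(m)g(n)` for coprime `m, n`) and `κ ≥ 0`, and assume
(H1) `|∑_{p ≤ Q} g(p) log p − κ log Q| ≤ L` for all `Q ≥ 2` (prime mean `κ`), and
(H2) `∑_{p ≤ N} g(p)² log p + ∑_{p ≤ N} ∑_{2 ≤ ν ≤ N} g(p^ν) log p^ν ≤ A` for all `N` (small prime-square
and prime-power mass).  Then the ordered Euler product `P = ∏_p (∑_ν g(p^ν)) (1 − 1/p)^κ` converges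
and `∑_{d ≤ D} g(d) ~ (P / Γ(κ+1)) (log D)^κ` as `D → ∞`.

*Proof.* Files I–IV establish the Abelian side: `P = e^{Φ(0)}` with `Φ = lim Φ_N` continuous on
`[0, ∞)` (III), the Dirichlet series `∑ (n g(n)) n^{-σ} = ∑ g(n) n^{-(σ-1)}` converges for `σ > 1`
and `(σ−1)^κ ∑ (n g(n)) n^{-σ} → P` as `σ → 1⁺` (IV).  Since `a_n = n g(n) ≥ 0`, the tree's PROVED
Hardy–Littlewood–Karamata Tauberian theorem for Dirichlet series
(`Literature.NumberTheory.LFunctions.HardyLittlewoodTauberianDirichlet_holds`, Montgomery–Vaughan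
Thm. 5.11) gives `∑_{n ≤ D} a_n / n = ∑_{d ≤ D} g(d) ~ (P/Γ(κ+1)) (log D)^κ`.  The `O((log D)^{κ−1})`
rate of the printed Lemma 5.4 is not claimed.

## References
* H. Halberstam, H.-E. Richert, *Sieve Methods*, Academic Press 1974, Lemma 5.4 (and Lemma 5.3).
* B. V. Levin, A. S. Faĭnleĭb, *Application of some integral equations to problems of number
  theory*, Uspehi Mat. Nauk 22 (1967), no. 3 (135), 119–197.
* H. L. Montgomery, R. C. Vaughan, *Multiplicative Number Theory I*, CUP 2007, Thm. 5.11.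
-/

namespace Literature.NumberTheory.LFunctions

namespace LevinFainleib

open Finset Real Filter
open scoped _root_.Topology

/-- **Levin–Faĭnleĭb / Halberstam–Richert Lemma 5.4 (asymptotic form, constant identified).**
For `g ≥ 0` multiplicative with prime mean `κ ≥ 0` in the sense of (H1)
`|∑_{p ≤ Q} g(p) log p − κ log Q| ≤ L` (`Q ≥ 2`) and with (H2)
`∑_{p ≤ N} g(p)² log p + ∑_{p ≤ N} ∑_{2 ≤ ν ≤ N} g(p^ν) log p^ν ≤ A` (all `N`), the ordered product
`∏_{p ≤ N} (∑_ν g(p^ν)) (1 − 1/p)^κ` converges to some `P` and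
`(∑_{d ≤ D} g(d)) / (log D)^κ → P / Γ(κ+1)`.  Proof: Euler product and Abel summation give
`(σ−1)^κ ∑ n g(n) n^{-σ} → P` (`σ → 1⁺`); conclude by the Hardy–Littlewood–Karamata Tauberian theorem
for Dirichlet series with `a_n = n g(n) ≥ 0`, `β = κ`. [cite: HalberstamRichert1974, Lemma 5.4] -/
theorem levinFainleib_asymp (g : ℕ → ℝ) (κ : ℝ) (hκ : 0 ≤ κ) (hg0 : ∀ n, 0 ≤ g n) (hg1 : g 1 = 1)
    (hmul : ∀ m n : ℕ, m.Coprime n → g (m * n) = g m * g n)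
    (h1 : ∃ L : ℝ, ∀ Q : ℕ, 2 ≤ Q →
      |(∑ p ∈ Nat.primesLE Q, g p * Real.log p) - κ * Real.log Q| ≤ L)
    (h2 : ∃ A : ℝ, ∀ N : ℕ, (∑ p ∈ Nat.primesLE N, g p ^ 2 * Real.log p) +
      (∑ p ∈ Nat.primesLE N, ∑ ν ∈ Finset.Icc 2 N, g (p ^ ν) * Real.log ((p : ℝ) ^ ν)) ≤ A) :
    ∃ P : ℝ,
      Tendsto (fun N : ℕ => ∏ p ∈ Nat.primesLE N, (∑' ν : ℕ, g (p ^ ν)) * (1 - 1 / (p : ℝ)) ^ κ)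
        atTop (𝓝 P) ∧
      Tendsto (fun D : ℕ => (∑ d ∈ Finset.Icc 1 D, g d) / Real.log D ^ κ) atTop
        (𝓝 (P / Real.Gamma (κ + 1))) := by
  obtain ⟨A, hA⟩ := h2
  obtain ⟨Φ, hΦ, hcont⟩ := exists_tendsto_logProduct hg0 hg1 hκ h1 hA
  refine ⟨Real.exp (Φ 0), tendsto_prod_primesLE_of_tendsto hg0 hg1 hA κ (hΦ 0 le_rfl), ?_⟩
  -- the Tauberian theorem with `a n = n * g n`, `β = κ`, `α = exp (Φ 0)`, `A = 0`
  have hS : ∀ σ : ℝ, 1 < σ → Summable fun n : ℕ => (n : ℝ) * g n / (n : ℝ) ^ σ := by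
    intro σ hσ
    refine (summable_div_rpow hg0 hg1 hmul hκ hA (by linarith : 0 < σ - 1)
      (hΦ (σ - 1) (by linarith))).congr fun n => ?_
    exact (mul_div_rpow_eq_div_rpow_sub_one g hσ n).symm
  have hT := HardyLittlewoodTauberianDirichlet_holds (fun n => (n : ℝ) * g n) (Real.exp (Φ 0)) κ 0
    hκ hS (tendsto_rpow_mul_tsum_sigma hg0 hg1 hmul hκ hA hΦ hcont) (fun n _ => by
      simpa using mul_nonneg (Nat.cast_nonneg n) (hg0 n))
  refine hT.congr fun D => ?_
  congr 1
  refine Finset.sum_congr rfl fun n hn => ?_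
  have hn0 : (n : ℝ) ≠ 0 := by
    have := (Finset.mem_Icc.mp hn).1
    exact_mod_cast (by omega : n ≠ 0)
  field_simp

end LevinFainleib

end Literature.NumberTheory.LFunctions
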